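import Summits.CriticalPhenomena.Ising3D.Control2DPolyCertAuto
import Summits.CriticalPhenomena.Ising3D.Control2DL13BoxLTable
import Summits.CriticalPhenomena.Ising3D.Control2DL13BoxLData13
import Summits.CriticalPhenomena.Ising3D.Control2DUZk13n47a
import Summits.CriticalPhenomena.Ising3D.Control2DUZk13n47b
import Summits.CriticalPhenomena.Ising3D.Control2DUZn47A
import Summits.CriticalPhenomena.Ising3D.Control2DUZn47c06a
import Summits.CriticalPhenomena.Ising3D.Control2DUZn47c06b
import Summits.CriticalPhenomena.Ising3D.Control2DUZn47c06c
import HarnessLib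

/-!
# Kernel replay of the RB-2 certificate `j110356_functional_deriv2d_L13_E032_sig1o8_box0.92-0.93.json` (Λ = 13, E₀ = 32): Δ_ε ∉ [23/25, 93/100] at Δ_σ = 1/8 under A2D′: cell data, spins 6
(cell `pub-ising3x`, seat controls-1 gen 17; KERNEL PATH for the 2D γ-certificates, Λ = 13 — CONTROL-ONLY)

HONEST FRAMING: lottery ticket; floor = tightest certified 3D Ising CFT bounds; no exact-solution
claim without a proof. CONTROL-ONLY (`d = 2`, `Δ_σ = 1/8`; axiom set A2D′).

Split layout (controls-1 g15): each spin's cell polynomial `cellPolyZ wtboxL slL13 13 ℓ Nd` is assembled in the kernel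
from the table-independent one-sided literals `uZ Nd c k` (library files `Control2DUZn*`, `Control2DUZL13n*`, `Control2DGammaL7U0n*e1005`)
into a literal `phat…` (`simp only` + `decide +kernel`); every Bernstein leaf `bernAuto phat q a L = true` (coefficients
computed in the kernel, `Control2DPolyCertAuto`) is its own kernel decision. This file is data + kernel decisions only; the cell theorems proper are assembled in `Control2DL13BoxLCells`.
All integers come from the seat's exact mirror (HOME/code/controls/kp3: kmirror.py / gen_cert.py, cross-checked against
the independent rational twin twin.py; controls-1 g17: HOME/code/controls/kp4) and are only CHECKED here. No facts, standard axioms only.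
-/

namespace Summit.CriticalPhenomena.Ising3D.Control2D

open Literature.MathematicalPhysics.QuantumFieldTheory.ConformalBootstrap3D

set_option maxHeartbeats 0 in
set_option maxRecDepth 200000 in
/-- **Kernel check of spin 6, leaf 5** (`y ∈ [13/4, 26/4]`, range C; Bernstein coefficients of the coefficients truncated by `10^303`, computed in the kernel). [folklore] -/
theorem cellChk_boxL_s6l5 : bernAuto (ptrunc phatboxLs6 303) 4 13 13 = true := by
  decide +kernel

set_option maxHeartbeats 0 in
set_option maxRecDepth 200000 in
/-- **Kernel check of spin 6, leaf 6** (`y ∈ [13/2, 26/2]`, range C; Bernstein coefficients of the coefficients truncated by `10^303`, computed in the kernel). [folklore] -/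
theorem cellChk_boxL_s6l6 : bernAuto (ptrunc phatboxLs6 303) 2 13 13 = true := by
  decide +kernel

end Summit.CriticalPhenomena.Ising3D.Control2D
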